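import Summits.QuantumFields.BalabanUV.Beta.EriceRemainderEnclosureHistoryAutonomyComparisonAgeCompositionReadVariation
import Summits.QuantumFields.BalabanUV.Beta.EriceRemainderEnclosureHistoryAutonomyComparisonAgeCompositionBVStabilityFlow

/-!
# EriceRemainderEnclosureHistoryAutonomyComparisonAgeCompositionOldRegularity — (E115e) route (N), first order: THE INCREASE OF AN OLD SURPLUS BELOW A PIN —
# ABSTRACT FOR TAIL-SUM KERNELS, AND ALONG EVERY FLOW FOR A LONE OLD AGE.  The KEY-free composition ((E115a–d)) asks of the old surplus `v = S_O e` only that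
# it INCREASE LITTLE over a few young windows below the pin (README `HOME/b2b-balaban-beta-d4-p2/g96/README.md` §3 (R1)).  §1 (abstract): for a tail-sum kernel
# `K m l = Σ_{l<k<A} w k m` (`w ≥ 0` non-increasing in the row) and a non-increasing excess, the zero-tailed solution `v` with `0 ≤ v ≤ V` below the pin `n`
# satisfies, at every depth `m ≥ n`, `v (m+1) − v m ≤ V·Σ_k [min k N·(w k m − w k (m+1)) + w k (m+1)]` (**`sol_step_increase_le`**) — the increase per row is
# the MASS DECAY plus the FIRST ENTRY — hence over a stretch `[n, b)`: `Inc_{[n,b)} v ≤ V·[Σ_k min k N·(w k n − w k b) + (b−n)·Σ_k w k n]`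
# (**`sol_increase_le`**).  §2 (flow): for a LONE old age `o` (`1 ≤ o < K ≤ N`) along every admissible flow, with `x̃_o(n) = o·L_oh_{n+o}³∕2 ≤ √2∕2`:
#     `Inc_{[n, n+D·y)} (S_o e) ≤ (5∕2)·x̃_o(n)·(D·y)∕o`      (**`flow_lone_old_increase_le`**; `e` non-increasing with `0 ≤ e ≤ 1`)
# — concavity `(n+o)·a_{b+o} ≤ (b+o)·a_{n+o}` ((E58b) `mul_invSq_add_le`) and `1 − u³ ≤ (3∕2)(1 − u²)`; with the light floor `S_o e (n) ≥ (1 − x̃_o(n))·e n`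
# ((E115a) `sol_ge_one_sub_row`) this is the RELATIVE REGULARITY `Inc_D v ≤ η·v(n)`, `η = (5∕2)·x̃_o·D·(y∕o)∕(1 − x̃_o) ≤ 8.6·D·y∕o`, that (E115b)
# `flow_young_surplus_nonneg_of_slow_increase` consumes: the composition step for a young age `y` under a lone old age `o` closes KEY-free as soon as the ratio
# `o∕y` beats `D·x̃_y·η`-type constants (README §6 (1)).  The multi-age version of §2 (relative, not absolute) is the remaining crux of the every-range route.

Cell `pub-balaban`, β-function sub-cell, BINDER row D4 «RemainderConst leaves for Bałaban's split» (`HOME/BINDER-OWNERS.md`; owner lineage `b2b-balaban-beta-an4`;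
this file by co-owner #2 lineage `b2b-balaban-beta-d4-p2`, generation 96), β-FLOW TEAM duty (1), FREEZE (0) honoured (def-free; imports (E115d), (E115b); uses (E115d)
`read_eq_sum_ages` ∕ `window_succ` ∕ `telescope_Ico`, (E71a) `sol_nonneg_le_of_antitone`, (E58b) `mul_invSq_add_le` BY NAME; the display of `KL` is (E80a)'s with
`g ≡ 1`; nothing restated).

HONEST FRAMING (page 1, verbatim and binding).  *"Discharging BetaPertH makes Bałaban's UV stability UNCONDITIONAL — a real constructive-QFT result; it is
NOT the continuum limit and NOT the Clay problem."*  THIS FILE DISCHARGES NOTHING OF THE KIND.  Elementary real analysis about ABSTRACT functionals on a box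
]0,γ]^ℕ with displayed floors, profiles and signs, and the FIRST-ORDER renewal objects of route (N) built from them — hypotheses of a census, not facts; the
form, signs, ages and moments of Bałaban's (1.22) limit functional are NOT PRINTED ([I] p. 298; GAPS G-t4-U2-1∕-2) and NOT asserted.  Row D4 class
UNCHANGED (critical-path width 0; instance 0∕1; D4 DISCHARGE NO DATE).  HONEST DEPENDENCY: continuum YM on T⁴ ⇐ BetaPertH ∧ nine spine estimates (0/9
proved); BetaPertH ⇐ (D1) ∧ (D4) ∧ CAP+tail; G-an2-4 gates asym, D1 and NE2/3/4.

NOT CLAIMED: the relative regularity of MULTI-AGE old surpluses; the young total-mass bound (R2); the END beyond the tree's classes; anything printed.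

WHAT IS PROVED ([folklore]; 0 `def`, 0 sorry).  §1 **`sol_step_increase_le`**, **`sol_increase_le`** (abstract).  §2 `one_sub_cube_le`, `lone_kernel_tail_form`,
**`flow_lone_old_increase_le`** (`Inc_{[n,b)} ≤ (5∕2)·(L_oh_{n+o}³∕2)·(b−n)`), **`flow_lone_old_increase_le_rel`** (with the floor `v n ≥ 1 − x̃_o(n)`).
-/
noncomputable section
open Finset

namespace Summit.QuantumFields.BalabanUV.Beta.EriceRemainderEnclosureHistoryAutonomyComparisonAgeCompositionOldRegularity

open Literature.MathematicalPhysics.QuantumFieldTheory.Balaban1983to89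
open Literature.MathematicalPhysics.QuantumFieldTheory.Balaban1983to89.T4BetaStationary
open Literature.MathematicalPhysics.QuantumFieldTheory.Balaban1983to89.T4BetaFlowWellPosed
open Summit.QuantumFields.BalabanUV.Beta.EriceRemainderEnclosureHistoryAutonomyComparisonAgeComposition (sol_nonneg_le_of_antitone)
open Summit.QuantumFields.BalabanUV.Beta.EriceRemainderEnclosureHistoryAutonomyComparisonAgeCompositionReadVariation (read_eq_sum_ages window_succ telescope_Ico)
open Summit.QuantumFields.BalabanUV.Beta.EriceRemainderEnclosureHistoryAutonomyComparisonAffineProfile (mul_invSq_add_le)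

section Abstract
variable {A N : ℕ} {w : ℕ → ℕ → ℝ} {K : ℕ → ℕ → ℝ} {R : (ℕ → ℝ) → ℕ → ℝ}

/-! ## §1 Abstract: the increase of a solution per row is mass decay plus first entry -/

/-- **THE INCREASE PER ROW.**  Tail-sum kernel, `w ≥ 0` non-increasing in the row; `e` non-increasing; `v` a solution (`v m = e m − R v m`) with `0 ≤ v ≤ V` at
the depths `> n`.  Then for every `m ≥ n`: `v (m+1) − v m ≤ V·Σ_{k∈[1,A)} (min k N·(w k m − w k (m+1)) + w k (m+1))`. [folklore] -/
theorem sol_step_increase_le (hR : ∀ u m, R u m = ∑ l ∈ range N, K m l * u (m + 1 + l)) (hK : ∀ m l, K m l = ∑ k ∈ Ico (l + 1) A, w k m)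
    (hw0 : ∀ k m, 0 ≤ w k m) (hwmono : ∀ k m, w k (m + 1) ≤ w k m)
    {e v : ℕ → ℝ} (hea : ∀ m, e (m + 1) ≤ e m) (hrec : ∀ m, v m = e m - R v m) {n : ℕ} {V : ℝ} (hvV : ∀ m, n < m → 0 ≤ v m ∧ v m ≤ V)
    {m : ℕ} (hm : n ≤ m) :
    v (m + 1) - v m ≤ V * ∑ k ∈ Ico 1 A, ((min k N : ℕ) * (w k m - w k (m + 1)) + w k (m + 1)) := by
  have hV0 : 0 ≤ V := (hvV (m + 1) (by omega)).1.trans (hvV (m + 1) (by omega)).2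
  rw [hrec (m + 1), hrec m, read_eq_sum_ages hR hK v m, read_eq_sum_ages hR hK v (m + 1)]
  have hterm : ∀ k ∈ Ico 1 A, w k m * ∑ l ∈ range (min k N), v (m + 1 + l) - w k (m + 1) * ∑ l ∈ range (min k N), v (m + 1 + 1 + l)
      ≤ V * (((min k N : ℕ) : ℝ) * (w k m - w k (m + 1)) + w k (m + 1)) := by
    intro k _
    rw [window_succ v m (min k N)]
    set W := ∑ l ∈ range (min k N), v (m + 1 + l) with hW
    have hWV : W ≤ (min k N : ℕ) * V := by
      calc W ≤ ∑ l ∈ range (min k N), V := sum_le_sum fun l _ => (hvV (m + 1 + l) (by omega)).2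
        _ = (min k N : ℕ) * V := by rw [sum_const, card_range, nsmul_eq_mul]
    have hW0 : 0 ≤ W := sum_nonneg fun l _ => (hvV (m + 1 + l) (by omega)).1
    have h1 := hw0 k (m + 1); have h2 := hwmono k m
    have h3 := (hvV (m + 1) (by omega)).2; have h4 := (hvV (m + 1 + min k N) (by omega)).1
    have h5 : (w k m - w k (m + 1)) * W ≤ (w k m - w k (m + 1)) * ((min k N : ℕ) * V) := mul_le_mul_of_nonneg_left hWV (by linarith)
    have h6 : w k (m + 1) * v (m + 1) ≤ w k (m + 1) * V := mul_le_mul_of_nonneg_left h3 h1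
    have h7 : 0 ≤ w k (m + 1) * v (m + 1 + min k N) := mul_nonneg h1 h4
    nlinarith
  have hsum := sum_le_sum hterm
  rw [sum_sub_distrib, ← mul_sum] at hsum
  linarith [hea m]

/-- **THE INCREASE OVER A STRETCH.**  In the same setting: `Σ_{m∈[n,b)} max (v (m+1) − v m) 0 ≤ V·[Σ_k min k N·(w k n − w k b) + (b − n)·Σ_k w k n]`. [folklore] -/
theorem sol_increase_le (hR : ∀ u m, R u m = ∑ l ∈ range N, K m l * u (m + 1 + l)) (hK : ∀ m l, K m l = ∑ k ∈ Ico (l + 1) A, w k m)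
    (hw0 : ∀ k m, 0 ≤ w k m) (hwmono : ∀ k m, w k (m + 1) ≤ w k m)
    {e v : ℕ → ℝ} (hea : ∀ m, e (m + 1) ≤ e m) (hrec : ∀ m, v m = e m - R v m) {n : ℕ} {V : ℝ} (hvV : ∀ m, n < m → 0 ≤ v m ∧ v m ≤ V)
    {b : ℕ} (hnb : n ≤ b) :
    ∑ m ∈ Ico n b, max (v (m + 1) - v m) 0
      ≤ V * (∑ k ∈ Ico 1 A, (min k N : ℕ) * (w k n - w k b) + (b - n : ℕ) * ∑ k ∈ Ico 1 A, w k n) := by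
  have hV0 : 0 ≤ V := (hvV (n + 1) (by omega)).1.trans (hvV (n + 1) (by omega)).2
  have hwn : ∀ k m, n ≤ m → w k m ≤ w k n := by
    intro k m hm
    induction m, hm using Nat.le_induction with
    | base => exact le_rfl
    | succ m _ ih => exact (hwmono k m).trans ih
  -- pointwise bound of the max by the (non-negative) step bound
  have hpt : ∀ m ∈ Ico n b, max (v (m + 1) - v m) 0 ≤ V * ∑ k ∈ Ico 1 A, ((min k N : ℕ) * (w k m - w k (m + 1)) + w k (m + 1)) := by
    intro m hm
    have hm' := (mem_Ico.mp hm).1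
    refine max_le (sol_step_increase_le hR hK hw0 hwmono hea hrec hvV hm') (mul_nonneg hV0 (sum_nonneg fun k _ => ?_))
    have := hw0 k (m + 1); have := hwmono k m; positivity
  refine (sum_le_sum hpt).trans ?_
  rw [← mul_sum]
  refine mul_le_mul_of_nonneg_left ?_ hV0
  rw [sum_comm]
  -- per age: telescoping of the decay + first entries
  have htel : ∀ k, ∑ m ∈ Ico n b, (w k m - w k (m + 1)) = w k n - w k b := by
    intro k
    by_cases hb0 : b = 0
    · subst hb0
      have hn0 : n = 0 := by omega
      subst hn0; simp
    · obtain ⟨M, rfl⟩ : ∃ M, b = M + 1 := ⟨b - 1, by omega⟩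
      exact telescope_Ico (fun m => w k m) M n hnb
  have hper : ∀ k ∈ Ico 1 A, ∑ m ∈ Ico n b, (((min k N : ℕ) : ℝ) * (w k m - w k (m + 1)) + w k (m + 1))
      ≤ ((min k N : ℕ) : ℝ) * (w k n - w k b) + ((b - n : ℕ) : ℝ) * w k n := by
    intro k _
    rw [sum_add_distrib, ← mul_sum, htel k]
    have hB : ∑ m ∈ Ico n b, w k (m + 1) ≤ ((b - n : ℕ) : ℝ) * w k n := by
      calc ∑ m ∈ Ico n b, w k (m + 1) ≤ ∑ m ∈ Ico n b, w k n :=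
            sum_le_sum fun m hm => hwn k (m + 1) (by have := (mem_Ico.mp hm).1; omega)
        _ = ((b - n : ℕ) : ℝ) * w k n := by rw [sum_const, Nat.card_Ico, nsmul_eq_mul]
    linarith
  refine (sum_le_sum hper).trans (le_of_eq ?_)
  rw [sum_add_distrib, mul_sum]

end Abstract

/-! ## §2 Along the flow: a lone old age -/

variable {B : (ℕ → ℝ) → ℝ} {γ b gIR : ℝ} {L : ℕ → ℝ} {K : ℕ} {h : ℕ → ℝ}

/-- `1 − u³ ≤ (3∕2)(1 − u²)` for `u ≥ 0` (`(u−1)²(2u+1) ≥ 0`). [folklore] -/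
theorem one_sub_cube_le {u : ℝ} (hu : 0 ≤ u) : 1 - u ^ 3 ≤ 3 / 2 * (1 - u ^ 2) := by
  nlinarith [sq_nonneg (u - 1), mul_nonneg hu (sq_nonneg (u - 1))]

/-- The undamped lone kernel of the age `o` is a tail-sum kernel with the single weight row `k = o`. [folklore] -/
theorem lone_kernel_tail_form {o : ℕ} (hoK : o < K)
    {KL : ℕ → ℕ → ℕ → ℝ} (hKL : ∀ k n l, KL k n l = if 0 < k ∧ k < K ∧ l < k then L k * h (n + k) ^ 3 / 2 else 0) (m l : ℕ) :
    KL o m l = ∑ k ∈ Ico (l + 1) K, (fun k m => if k = o then L o * h (m + o) ^ 3 / 2 else 0) k m := by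
  rw [hKL]
  by_cases hl : l < o
  · rw [sum_ite_eq' (Ico (l + 1) K) o, if_pos (mem_Ico.mpr ⟨by omega, hoK⟩)]
    by_cases ho : 0 < o
    · rw [if_pos ⟨ho, hoK, hl⟩]
    · omega
  · rw [if_neg (by omega), sum_ite_eq' (Ico (l + 1) K) o, if_neg (by rw [mem_Ico]; omega)]

/-- **THE INCREASE OF A LONE OLD SURPLUS BELOW A PIN (every admissible flow, undamped).**  `B` an isotone memory with floor `b > 0` dominating `L ≥ 0` on the
ages `< K`; `h` a box solution; `1 ≤ o < K ≤ N`; `KL o` the undamped lone kernel of the age `o` with reads `Ro` on the horizon `N`; `e` non-increasing with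
`0 ≤ e ≤ 1`; `v` the zero-tailed solution of `v = e − Ro v`.  Then for every pin `n` and every stretch `[n, b)`:
`Σ_{m∈[n,b)} max (v (m+1) − v m) 0 ≤ (5∕2)·(L_oh_{n+o}³∕2)·(b − n)` — i.e. `(5∕2)·x̃_o(n)·(b−n)∕o` with the window load `x̃_o(n) = o·L_oh_{n+o}³∕2 ≤ √2∕2`.
[folklore] -/
theorem flow_lone_old_increase_le (hmono : ∀ u v : ℕ → ℝ, SeqBox γ u → SeqBox γ v → (∀ j, u j ≤ v j) → B u ≤ B v)
    (hL : ∀ k, 0 ≤ L k) (hb : 0 < b) (hlo : ∀ u, SeqBox γ u → b ≤ B u) (hdom : ∀ u, SeqBox γ u → ∑ k ∈ range K, L k * u k ≤ B u)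
    (hh : SeqBox γ h) (hf : MemFlow B gIR h)
    {o : ℕ} (ho : 1 ≤ o) (hoK : o < K) {N : ℕ} (hKN : K ≤ N)
    {KL : ℕ → ℕ → ℕ → ℝ} (hKL : ∀ k n l, KL k n l = if 0 < k ∧ k < K ∧ l < k then L k * h (n + k) ^ 3 / 2 else 0)
    {Ro : (ℕ → ℝ) → ℕ → ℝ} (hRo : ∀ u m, Ro u m = ∑ l ∈ range N, KL o m l * u (m + 1 + l))
    {e v : ℕ → ℝ} (he0 : ∀ m, 0 ≤ e m) (he1 : ∀ m, e m ≤ 1) (hea : ∀ m, e (m + 1) ≤ e m)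
    (hvt : ∀ m, N < m → v m = 0) (hrec : ∀ m, v m = e m - Ro v m) {n b' : ℕ} (hnb : n ≤ b') :
    ∑ m ∈ Ico n b', max (v (m + 1) - v m) 0 ≤ 5 / 2 * (L o * h (n + o) ^ 3 / 2) * ((b' - n : ℕ) : ℝ) := by
  have hpos : ∀ j, 0 < h j := fun j => (hh j).1
  have hgIR : 0 < gIR := by rw [← hf.1]; exact hpos 0
  set w : ℕ → ℕ → ℝ := fun k m => if k = o then L o * h (m + o) ^ 3 / 2 else 0 with hw
  have hKt : ∀ m l, KL o m l = ∑ k ∈ Ico (l + 1) K, w k m := fun m l => lone_kernel_tail_form hoK hKL m l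
  have hc0 : ∀ m, 0 ≤ L o * h (m + o) ^ 3 / 2 := fun m => by have := hL o; have := hpos (m + o); positivity
  have hanti : Antitone h :=
    (Summit.QuantumFields.BalabanUV.Beta.EriceRemainderEnclosureHistoryAutonomyOrder.strictAnti_of_memFlow hb hlo hh hf).antitone
  have hcmono : ∀ m, L o * h (m + 1 + o) ^ 3 / 2 ≤ L o * h (m + o) ^ 3 / 2 := fun m => by
    have h1 : h (m + 1 + o) ≤ h (m + o) := hanti (by omega)
    have h2 := pow_le_pow_left₀ (le_of_lt (hpos (m + 1 + o))) h1 3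
    have := hL o; nlinarith
  have hw0 : ∀ k m, 0 ≤ w k m := fun k m => by
    simp only [hw]; split_ifs
    · exact hc0 m
    · exact le_rfl
  have hwmono : ∀ k m, w k (m + 1) ≤ w k m := fun k m => by
    simp only [hw]; split_ifs
    · exact hcmono m
    · exact le_rfl
  -- the lone kernel: non-negative, rows ≤ x̃ ≤ √2∕2 ≤ 1, hence 0 ≤ v ≤ e ≤ 1
  obtain ⟨hKo0, -, hr, hcap⟩ :=
    Summit.QuantumFields.BalabanUV.Beta.EriceRemainderEnclosureHistoryAutonomyComparisonAgeCompositionBVStabilityFlow.young_kernel_facts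
      hmono hL hb hlo hdom hh hf ho hoK hKL N
  have hs2 : Real.sqrt 2 / 2 ≤ 1 := by
    have : Real.sqrt 2 ≤ 2 := by
      rw [show (2 : ℝ) = Real.sqrt (2 ^ 2) by rw [Real.sqrt_sq (by norm_num)]]
      exact Real.sqrt_le_sqrt (by norm_num)
    linarith
  have hrow1 : ∀ m, ∑ l ∈ range N, KL o m l ≤ 1 := fun m => ((hr m).trans (hcap m)).trans hs2
  have hv := sol_nonneg_le_of_antitone hRo hKo0 hrow1 he0 hea hvt hrec
  have hvV : ∀ m, n < m → 0 ≤ v m ∧ v m ≤ 1 := fun m _ => ⟨(hv m).1, (hv m).2.trans (he1 m)⟩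
  -- abstract increase bound with V = 1
  have hinc := sol_increase_le (A := K) hRo hKt hw0 hwmono hea hrec hvV hnb
  rw [one_mul] at hinc
  -- evaluate the age sums: only k = o contributes
  have hoI : o ∈ Ico 1 K := mem_Ico.mpr ⟨ho, hoK⟩
  have hmin : min o N = o := min_eq_left (by omega)
  have hs1 : ∑ k ∈ Ico 1 K, ((min k N : ℕ) : ℝ) * (w k n - w k b') = (o : ℝ) * (L o * h (n + o) ^ 3 / 2 - L o * h (b' + o) ^ 3 / 2) := by
    have : ∀ k ∈ Ico 1 K, ((min k N : ℕ) : ℝ) * (w k n - w k b') = if k = o then (o : ℝ) * (L o * h (n + o) ^ 3 / 2 - L o * h (b' + o) ^ 3 / 2) else 0 := by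
      intro k _; simp only [hw]; split_ifs with hk
      · subst hk; rw [hmin]
      · ring
    rw [sum_congr rfl this, sum_ite_eq' (Ico 1 K) o, if_pos hoI]
  have hs2' : ∑ k ∈ Ico 1 K, w k n = L o * h (n + o) ^ 3 / 2 := by
    simp only [hw]; rw [sum_ite_eq' (Ico 1 K) o, if_pos hoI]
  rw [hs1, hs2'] at hinc
  -- the flow: o·(c n − c b') ≤ (3/2)·c n·(b' − n)
  set p := h (n + o) with hp
  set q := h (b' + o) with hq
  have hp0 : 0 < p := hpos _
  have hq0 : 0 < q := hpos _
  have hqp : q ≤ p := hanti (by omega)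
  -- concavity through the origin: (n+o)·p² ≤ (b'+o)·q²
  have hcv := mul_invSq_add_le hmono hb hlo hgIR hh hf (n + o) (b' - n)
  rw [show n + o + (b' - n) = b' + o by omega] at hcv
  have hcv' : ((n + o : ℕ) : ℝ) * p ^ 2 ≤ (((n + o : ℕ) : ℝ) + ((b' - n : ℕ) : ℝ)) * q ^ 2 := by
    rw [div_eq_mul_inv, div_eq_mul_inv, one_mul, one_mul] at hcv
    have e1 : ((n + o : ℕ) : ℝ) * (q ^ 2)⁻¹ * (p ^ 2 * q ^ 2) = ((n + o : ℕ) : ℝ) * p ^ 2 := by field_simp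
    have e2 : (((n + o : ℕ) : ℝ) + ((b' - n : ℕ) : ℝ)) * (p ^ 2)⁻¹ * (p ^ 2 * q ^ 2) = (((n + o : ℕ) : ℝ) + ((b' - n : ℕ) : ℝ)) * q ^ 2 := by
      field_simp
    have := mul_le_mul_of_nonneg_right hcv (show 0 ≤ p ^ 2 * q ^ 2 by positivity)
    rw [e1, e2] at this; exact this
  have hcube : p ^ 3 - q ^ 3 ≤ 3 / 2 * p * (p ^ 2 - q ^ 2) := by
    nlinarith [mul_nonneg (sq_nonneg (p - q)) (show 0 ≤ p + 2 * q by linarith)]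
  -- p² − q² ≤ p²·(b'−n)/(b'+o), and o/(b'+o) ≤ 1
  have hno : (0 : ℝ) < ((n + o : ℕ) : ℝ) := by exact_mod_cast (show 0 < n + o by omega)
  have hkey : (o : ℝ) * (p ^ 3 - q ^ 3) ≤ 3 / 2 * p ^ 3 * ((b' - n : ℕ) : ℝ) := by
    have hbn0 : (0 : ℝ) ≤ ((b' - n : ℕ) : ℝ) := Nat.cast_nonneg _
    have ho' : (o : ℝ) ≤ ((n + o : ℕ) : ℝ) := by exact_mod_cast (show o ≤ n + o by omega)
    -- (n+o)(p² − q²) ≤ (b'−n) q² ≤ (b'−n) p²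
    have h1 : ((n + o : ℕ) : ℝ) * (p ^ 2 - q ^ 2) ≤ ((b' - n : ℕ) : ℝ) * q ^ 2 := by nlinarith
    have h2 : ((b' - n : ℕ) : ℝ) * q ^ 2 ≤ ((b' - n : ℕ) : ℝ) * p ^ 2 :=
      mul_le_mul_of_nonneg_left (pow_le_pow_left₀ hq0.le hqp 2) hbn0
    have h3 : (o : ℝ) * (p ^ 2 - q ^ 2) ≤ ((b' - n : ℕ) : ℝ) * p ^ 2 := by
      have hpq2 : 0 ≤ p ^ 2 - q ^ 2 := by nlinarith [pow_le_pow_left₀ hq0.le hqp 2]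
      calc (o : ℝ) * (p ^ 2 - q ^ 2) ≤ ((n + o : ℕ) : ℝ) * (p ^ 2 - q ^ 2) := mul_le_mul_of_nonneg_right ho' hpq2
        _ ≤ ((b' - n : ℕ) : ℝ) * p ^ 2 := h1.trans h2
    have h4 : (o : ℝ) * (p ^ 3 - q ^ 3) ≤ (o : ℝ) * (3 / 2 * p * (p ^ 2 - q ^ 2)) := mul_le_mul_of_nonneg_left hcube (Nat.cast_nonneg o)
    nlinarith [mul_le_mul_of_nonneg_left h3 (show 0 ≤ 3 / 2 * p by positivity)]
  have hLo := hL o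
  have hfin : (o : ℝ) * (L o * p ^ 3 / 2 - L o * q ^ 3 / 2) ≤ 3 / 2 * (L o * p ^ 3 / 2) * ((b' - n : ℕ) : ℝ) := by
    have := mul_le_mul_of_nonneg_left hkey (show 0 ≤ L o / 2 by positivity)
    nlinarith
  calc ∑ m ∈ Ico n b', max (v (m + 1) - v m) 0
      ≤ (o : ℝ) * (L o * p ^ 3 / 2 - L o * q ^ 3 / 2) + ((b' - n : ℕ) : ℝ) * (L o * p ^ 3 / 2) := hinc
    _ ≤ 3 / 2 * (L o * p ^ 3 / 2) * ((b' - n : ℕ) : ℝ) + ((b' - n : ℕ) : ℝ) * (L o * p ^ 3 / 2) := by linarith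
    _ = 5 / 2 * (L o * p ^ 3 / 2) * ((b' - n : ℕ) : ℝ) := by ring

/-- **RELATIVE REGULARITY OF A LONE OLD SURPLUS.**  Same setting, `e = 1_{[0,J]}` (`J ≤ N`), `n ≤ J`, `x̃ = o·L_oh_{n+o}³∕2`: `v n ≥ 1 − x̃` ((E115a) light floor) and
`Inc_{[n, n+D·y)} v ≤ (5∕2)·(x̃∕o)·D·y`, so `Inc ≤ η·v n` with `η = (5∕2)·x̃·D·y∕(o·(1 − x̃))` whenever `x̃ < 1` — the hypothesis of (E115b)
`flow_young_surplus_nonneg_of_slow_increase` for a young age `y` under the lone old age `o`, with `η = O(D·y∕o)`. [folklore] -/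
theorem flow_lone_old_increase_le_rel (hmono : ∀ u v : ℕ → ℝ, SeqBox γ u → SeqBox γ v → (∀ j, u j ≤ v j) → B u ≤ B v)
    (hL : ∀ k, 0 ≤ L k) (hb : 0 < b) (hlo : ∀ u, SeqBox γ u → b ≤ B u) (hdom : ∀ u, SeqBox γ u → ∑ k ∈ range K, L k * u k ≤ B u)
    (hh : SeqBox γ h) (hf : MemFlow B gIR h)
    {o : ℕ} (ho : 1 ≤ o) (hoK : o < K) {N : ℕ} (hKN : K ≤ N)
    {KL : ℕ → ℕ → ℕ → ℝ} (hKL : ∀ k n l, KL k n l = if 0 < k ∧ k < K ∧ l < k then L k * h (n + k) ^ 3 / 2 else 0)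
    {Ro So : (ℕ → ℝ) → ℕ → ℝ} (hRo : ∀ u m, Ro u m = ∑ l ∈ range N, KL o m l * u (m + 1 + l))
    (hSo : ∀ w : ℕ → ℝ, (∀ n, N < n → w n = 0) → (∀ n, N < n → So w n = 0) ∧ ∀ n, So w n = w n - Ro (So w) n)
    {J : ℕ} (hJ : J ≤ N) {n : ℕ} (hnJ : n ≤ J) (D y : ℕ) :
    1 - (o : ℝ) * (L o * h (n + o) ^ 3 / 2) ≤ So (fun m => if m ≤ J then (1 : ℝ) else 0) n ∧
    ∑ m ∈ Ico n (n + D * y), max (So (fun m => if m ≤ J then (1 : ℝ) else 0) (m + 1) - So (fun m => if m ≤ J then (1 : ℝ) else 0) m) 0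
      ≤ 5 / 2 * (L o * h (n + o) ^ 3 / 2) * ((D * y : ℕ) : ℝ) := by
  have hind_t : ∀ m, N < m → (fun m => if m ≤ J then (1 : ℝ) else 0) m = 0 := fun m hm => if_neg (show ¬ m ≤ J by omega)
  have he0 : ∀ m, 0 ≤ (fun m => if m ≤ J then (1 : ℝ) else 0) m := fun m => by
    show (0 : ℝ) ≤ (if m ≤ J then (1 : ℝ) else 0); split_ifs <;> norm_num
  have he1 : ∀ m, (fun m => if m ≤ J then (1 : ℝ) else 0) m ≤ 1 := fun m => by
    show (if m ≤ J then (1 : ℝ) else 0) ≤ 1; split_ifs <;> norm_num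
  have hea : ∀ m, (fun m => if m ≤ J then (1 : ℝ) else 0) (m + 1) ≤ (fun m => if m ≤ J then (1 : ℝ) else 0) m := fun m => by
    show (if m + 1 ≤ J then (1 : ℝ) else 0) ≤ (if m ≤ J then (1 : ℝ) else 0)
    by_cases h1 : m + 1 ≤ J
    · rw [if_pos h1, if_pos (by omega)]
    · rw [if_neg h1]; split_ifs <;> norm_num
  refine ⟨?_, ?_⟩
  · have h3 := (Summit.QuantumFields.BalabanUV.Beta.EriceRemainderEnclosureHistoryAutonomyComparisonAgeCompositionBVStabilityFlow.young_indicator_sol_bounds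
      hmono hL hb hlo hdom hh hf ho hoK hKL hRo hSo hJ n).2.2 hnJ
    exact h3
  · have h := flow_lone_old_increase_le hmono hL hb hlo hdom hh hf ho hoK hKN hKL hRo he0 he1 hea (hSo _ hind_t).1 (hSo _ hind_t).2
      (n := n) (b' := n + D * y) (by omega)
    rw [show n + D * y - n = D * y by omega] at h
    exact h

end Summit.QuantumFields.BalabanUV.Beta.EriceRemainderEnclosureHistoryAutonomyComparisonAgeCompositionOldRegularity

end
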